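import Literature.Geometry.Riemannian.ThreeShrinkerClassification
import Literature.Geometry.Riemannian.GaussianShrinker
import Literature.Geometry.Lorentzian.PositiveMassRigidityProofs
import Literature.Geometry.Lorentzian.RiemannianVolumeIsometry
import Literature.Geometry.Riemannian.CutLocusBishopExp
import Literature.Geometry.Riemannian.NonTrappingConvexSublevelProofs
import Literature.Geometry.Riemannian.PerelmanEntropyCutoff
import Literature.Geometry.Riemannian.RicciFlowScalarMaximumPrinciple
import HarnessLib

/-!
# The flat case of the classification of three-dimensional gradient shrinkers: a complete flat
# normalised shrinker is the Gaussian soliton (disjunct (o) of the model data)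

Fourth companion of `ThreeShrinkerClassification.lean` (named fact
`Literature.Geometry.Riemannian.threeShrinkerClassification_modelData`, the classification of
complete three-dimensional gradient shrinking Ricci solitons — Munteanu–Wang arXiv:1606.01861,
Thm. 1.2 — exported as the model data of a normalised shrinker). This file PROVES, for the binder
of that fact, its **flat case in full**: if `(N³, h, φ)` is a complete connected normalised gradient
shrinker (`Ric + Hess φ = ½ h`, `R + |∇φ|² = φ`) whose Levi-Civita connection is flat, then
disjunct (o) holds: `R ≡ 0` and `∫_N e^{-φ} dV_h = (4π)^{3/2} = 8π√π`. This is derivation (o) of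
the fact's docstring,

> "`(N, h) ≅ ℝ³`, `Hess φ = ½ δ` gives `φ = |x − a|²/4 + c`, the normalisation `0 + |x − a|²/4 = φ`
> gives `c = 0`, and `∫_{ℝ³} e^{-|x−a|²/4} dx = (4π)^{3/2}` (a flat quotient `ℝ³/Γ` carries no such
> `φ`: `Γ` would fix the minimum point `a`)",

including the exclusion of the nontrivial flat space forms, carried out on the development
(exponential map) `devel : E = T_pN → N` of the tree's flat Cartan–Hadamard theory
(`FlatDevelopment.lean`, `FlatCovering.lean`: `devel` is a smooth local isometry for the constant
metric `h_p`, a covering map with affine deck transformations, Lee 2018, Thm. 12.8):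

1. `apply_devel_line_eq` — **the potential is quadratic along developed lines**: since lines
   develop onto geodesics with `h(γ', γ') ≡ h_p(u, u)` (`isGeodesic_devel_line`) and
   `(φ ∘ γ)'' = Hess φ (γ', γ') = ½ h(γ', γ')` (`hasDerivAt_mvfderiv_velocity_of_isGeodesicOn`;
   `Ric = 0` on a flat manifold),
   `φ(devel(w + t u)) = φ(devel w) + t dφ(d devel_w u) + ¼ t² h_p(u,u)`;
   hence `apply_devel_eq_quadratic`: `φ ∘ devel (v) = φ(p) + ℓ(v) + ¼ h_p(v, v)` with `ℓ` linear,
   and completing the square (`apply_devel_eq_min_add`), `φ ∘ devel (v) = c + ¼ h_p(v − m, v − m)`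
   with the unique minimiser `m = −2 ℓ^♯`.
2. `devel_injective_of_hessian_eq` — **the development is injective** ("`Γ` would fix the
   minimum point"): two points of a fibre differ by an affine deck transformation `τ`
   (`exists_deck`), `φ ∘ devel ∘ τ = φ ∘ devel` forces `τ m = m`, and a deck transformation
   with a fixed point is the identity (`affine_eq_id_of_devel_comp`).
3. `exists_isometry_euclidean_of_isFlat` — hence (`exists_diffeomorph_of_bijective_devel`,
   `exists_continuousLinearEquiv_inner_eq`, as in `PositiveMassRigidityProofs.lean`) there is a
   diffeomorphism `Ψ : N ≅ ℝ³` with `Ψ^* δ = h` and `φ = c + |Ψ − a|²/4`; with the normalisation,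
   `c = 0` (`exists_isometry_euclidean_of_isFlat_of_normalised`: at the minimum point `R = 0`
   and `dφ = 0`).
4. `modelData_o_of_isFlat_gaussianIntegral` — **disjunct (o), reduced to the model integral**:
   `R ≡ 0`, and by the change of variables along the isometry `Ψ`
   (`Diffeomorph.lintegral_comp_riemannianMeasure`),
   `∫_N e^{-φ} dV_h = ∫_{ℝ³} e^{-|y−a|²/4} dV_δ`; the right-hand side is `8π√π` by `dV_δ = dx`
   and the Gaussian integral (`ThreeShrinker.riemannianMeasure_euclideanMetric`,
   `ThreeShrinker.lintegral_exp_neg_norm_sub_sq_div_four` of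
   `ThreeShrinkerClassificationProofs.lean`, assembled in a sequel so that this file does not
   depend on that one).

What is NOT here: that a complete noncompact three-dimensional shrinker with `Sect ≥ 0` which
is not a cylinder quotient is flat (B.-L. Chen; Ni–Wallach; Cao–Chen–Zhu, Prop. 4.7) — the input
that routes a shrinker to this case. Everything is proved; no definitions of `Prop` type, no
named facts (D-0026).

## References

* O. Munteanu, J. Wang, *Structure at infinity for shrinking Ricci solitons*, arXiv:1606.01861,
  Thm. 1.2 (p. 3). [MunteanuWang2016]
* H.-D. Cao, B.-L. Chen, X.-P. Zhu, *Recent developments on Hamilton's Ricci flow*, Surveys in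
  Differential Geometry XII (2008), Lemma 4.6 and Prop. 4.7 (pp. 77–78). [CaoChenZhu2007]
* H.-D. Cao, R. S. Hamilton, T. Ilmanen, *Gaussian densities and stability for some Ricci
  solitons*, arXiv:math/0404165 (2004), §§3–4 (`Θ(ℝⁿ) = 1`). [CaoHamiltonIlmanen2004]
* J. M. Lee, *Introduction to Riemannian Manifolds*, 2nd ed. (2018), Thm. 12.8 (Cartan–Hadamard)
  and Cor. 12.3. [Lee2018]
-/

noncomputable section

open Bundle Set Function Filter Module MeasureTheory
open scoped Manifold ContDiff Topology ENNReal NNReal RealInnerProductSpace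

namespace Literature.Geometry.Riemannian

open Lorentzian Lorentzian.PseudoRiemannianMetric

namespace ThreeShrinker

/-! ### One-variable calculus: functions with constant second derivative are quadratic -/

/-- If `F' = G` and `G' ≡ c` on `ℝ` then `F t = F 0 + G 0 · t + c t²/2`. [folklore] -/
theorem eq_quadratic_of_hasDerivAt {F G : ℝ → ℝ} {c : ℝ} (hF : ∀ t, HasDerivAt F (G t) t)
    (hG : ∀ t, HasDerivAt G c t) (t : ℝ) : F t = F 0 + G 0 * t + c * t ^ 2 / 2 := by
  -- `G t = G 0 + c t`
  have hG' : ∀ s, G s = G 0 + c * s := by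
    intro s
    have hK : ∀ x, HasDerivAt (fun y ↦ G y - c * y) 0 x := fun x ↦
      ((hG x).sub ((hasDerivAt_id' x).const_mul c)).congr_deriv (by ring)
    have h := is_const_of_deriv_eq_zero (fun x ↦ (hK x).differentiableAt) (fun x ↦ (hK x).deriv)
      s 0
    simp only [mul_zero, sub_zero] at h
    linarith
  -- `F t - G 0 t - c t²/2` is constant
  have hK : ∀ x, HasDerivAt (fun y ↦ F y - (G 0 * y + c * y ^ 2 / 2)) 0 x := by
    intro x
    have ha : HasDerivAt (fun y : ℝ ↦ G 0 * y) (G 0 * 1) x := (hasDerivAt_id' x).const_mul (G 0)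
    have hb : HasDerivAt (fun y : ℝ ↦ c * y ^ 2 / 2) (c * (↑(2 : ℕ) * x ^ (2 - 1)) / 2) x :=
      ((hasDerivAt_pow 2 x).const_mul c).div_const 2
    have h1 : HasDerivAt (fun y : ℝ ↦ G 0 * y + c * y ^ 2 / 2) (G 0 + c * x) x :=
      (ha.add hb).congr_deriv (by push_cast; ring)
    exact ((hF x).sub h1).congr_deriv (by rw [hG' x]; ring)
  have h := is_const_of_deriv_eq_zero (fun x ↦ (hK x).differentiableAt) (fun x ↦ (hK x).deriv) t 0
  simp only [mul_zero, ne_eq, OfNat.ofNat_ne_zero, not_false_eq_true, zero_pow, zero_div,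
    add_zero, sub_zero] at h
  linarith

/-- **Completing the square** for `Q(v) = c + ℓ(v) + κ B(v, v)/2` with `B` symmetric and a point
`m` with `B(m, ·) = −κ⁻¹ ℓ` (the critical point): `Q(v) = Q(m) + κ B(v − m, v − m)/2`.
[folklore] -/
theorem quadratic_eq_apply_min_add {V : Type*} [NormedAddCommGroup V] [NormedSpace ℝ V]
    (B : V →L[ℝ] V →L[ℝ] ℝ) (hB : ∀ v w, B v w = B w v) (ℓ : V →L[ℝ] ℝ) {κ : ℝ} (hκ : κ ≠ 0)
    {m : V} (hm : ∀ w, B m w = -(κ⁻¹ * ℓ w)) (c : ℝ) (v : V) :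
    c + ℓ v + κ * B v v / 2 = (c + ℓ m + κ * B m m / 2) + κ * B (v - m) (v - m) / 2 := by
  have e1 : B (v - m) (v - m) = B v v - 2 * B m v + B m m := by
    rw [B.map_sub₂, map_sub, map_sub, hB v m]; ring
  have e2 : ℓ v = -κ * B m v := by
    have h := hm v
    field_simp at h
    linarith
  have e3 : ℓ m = -κ * B m m := by
    have h := hm m
    field_simp at h
    linarith
  rw [e1, e2, e3]
  ring

/-! ### The potential along the development of a flat manifold -/

section Devel

variable {E : Type*} [NormedAddCommGroup E] [NormedSpace ℝ E] [FiniteDimensional ℝ E]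
  [CompleteSpace E] {M : Type*} [TopologicalSpace M] [ChartedSpace E M] [IsManifold 𝓘(ℝ, E) ∞ M]
  [T2Space M] (g : PseudoRiemannianMetric 𝓘(ℝ, E) ∞ E (TangentSpace 𝓘(ℝ, E) : M → Type _))
  [g.HasLeviCivita] (hc : IsGeodesicallyComplete g.leviCivita) (p : M)

/-- **A function with `Hess φ = κ g` is quadratic along developed lines** of a complete flat
metric: `φ(devel(w + t u)) = φ(devel w) + t · dφ(γ'(0)) + κ g_p(u, u) t²/2`, where
`γ(t) = devel(w + t u)` is the developed line (a geodesic with `g(γ', γ') ≡ g_p(u, u)`,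
`isGeodesic_devel_line`) — because `(φ ∘ γ)'' = Hess φ(γ', γ') = κ g(γ', γ')`
(`hasDerivAt_mvfderiv_velocity_of_isGeodesicOn`). [cite: Lee2018, Ch. 12, Thm. 12.8] -/
theorem apply_devel_line_eq (hflat : g.leviCivita.IsFlat) {φ : M → ℝ}
    (hφ : ContMDiff 𝓘(ℝ, E) 𝓘(ℝ, ℝ) ∞ φ) {κ : ℝ}
    (hHess : ∀ (x : M) (v : TangentSpace 𝓘(ℝ, E) x), g.hessian φ x v v = κ * g.val x v v)
    (w u : E) (t : ℝ) :
    φ (g.devel hc p (w + t • u)) = φ (g.devel hc p (w + (0 : ℝ) • u)) +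
      mvfderiv 𝓘(ℝ, E) φ (g.devel hc p (w + (0 : ℝ) • u))
        (velocity 𝓘(ℝ, E) (fun s ↦ g.devel hc p (w + s • u)) 0) * t +
      κ * g.val p u u * t ^ 2 / 2 := by
  set γ : ℝ → M := fun s ↦ g.devel hc p (w + s • u) with hγ
  obtain ⟨hgeo, hvel⟩ := g.isGeodesic_devel_line hc p hflat w u
  have hF : ∀ s, HasDerivAt (fun s' ↦ φ (γ s'))
      (mvfderiv 𝓘(ℝ, E) φ (γ s) (velocity 𝓘(ℝ, E) γ s)) s := fun s ↦
    hasDerivAt_comp_curve_mvfderiv (hφ.contMDiffAt.mdifferentiableAt (by simp))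
      (g.mdifferentiableAt_devel_line hc p hflat w u s)
  have hG : ∀ s, HasDerivAt (fun s' ↦ mvfderiv 𝓘(ℝ, E) φ (γ s') (velocity 𝓘(ℝ, E) γ s'))
      (κ * g.val p u u) s := by
    intro s
    have h := g.hasDerivAt_mvfderiv_velocity_of_isGeodesicOn hgeo (mem_univ s)
      (f := φ) ((hφ.of_le (WithTop.coe_le_coe.2 le_top)).contMDiffAt)
    rw [hHess, hvel s] at h
    exact h
  exact eq_quadratic_of_hasDerivAt hF hG t

/-- **`φ ∘ devel` is an explicit quadratic function**: `φ(devel v) = φ(devel 0) + ℓ v +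
κ g_p(v, v)/2` with the linear `ℓ = dφ ∘ d(devel)_0` (`apply_devel_line_eq` on the line through
the origin, `velocity_comp_line_zero`). [cite: Lee2018, Ch. 12, Thm. 12.8] -/
theorem apply_devel_eq_quadratic (hflat : g.leviCivita.IsFlat) {φ : M → ℝ}
    (hφ : ContMDiff 𝓘(ℝ, E) 𝓘(ℝ, ℝ) ∞ φ) {κ : ℝ}
    (hHess : ∀ (x : M) (v : TangentSpace 𝓘(ℝ, E) x), g.hessian φ x v v = κ * g.val x v v)
    (v : E) :
    φ (g.devel hc p v) = φ (g.devel hc p 0) +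
      mvfderiv 𝓘(ℝ, E) φ (g.devel hc p 0) (mfderiv 𝓘(ℝ, E) 𝓘(ℝ, E) (g.devel hc p) 0 v) +
      κ * g.val p v v / 2 := by
  have h := apply_devel_line_eq g hc p hflat hφ hHess 0 v 1
  have hd : MDifferentiableAt 𝓘(ℝ, E) 𝓘(ℝ, E) (g.devel hc p) (0 : E) :=
    (g.contMDiff_devel hc p hflat 0).mdifferentiableAt (by simp)
  have hv := velocity_comp_line_zero (Φ := g.devel hc p) (w := (0 : E)) hd v
  -- transport the velocity identity to the point `devel 0`
  have key : ∀ (a : M) (ha : a = g.devel hc p 0) (b : TangentSpace 𝓘(ℝ, E) a),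
      HEq b (mfderiv 𝓘(ℝ, E) 𝓘(ℝ, E) (g.devel hc p) 0 v) →
      φ a = φ (g.devel hc p 0) ∧ mvfderiv 𝓘(ℝ, E) φ a b =
        mvfderiv 𝓘(ℝ, E) φ (g.devel hc p 0) (mfderiv 𝓘(ℝ, E) 𝓘(ℝ, E) (g.devel hc p) 0 v) := by
    rintro a rfl b hb
    rw [heq_iff_eq] at hb
    subst hb
    exact ⟨rfl, rfl⟩
  have hpt : g.devel hc p ((0 : E) + (0 : ℝ) • v) = g.devel hc p 0 := by simp
  obtain ⟨h1, h2⟩ := key _ hpt _ (heq_of_eq hv)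
  have h0 : φ (g.devel hc p ((0 : E) + (1 : ℝ) • v)) = φ (g.devel hc p v) := by simp
  rw [h0, h1, h2] at h
  linarith

omit [CompleteSpace E] [T2Space M] in
/-- The critical point of `φ ∘ devel`: a vector `m` with `g_p(m, ·) = −κ⁻¹ ℓ` (index raising by
the nondegenerate `g_p`). [folklore] -/
theorem exists_val_eq_neg_linearPart (φ : M → ℝ) (κ : ℝ) :
    ∃ m : E, ∀ w : E, g.val p m w =
      -(κ⁻¹ *
        mvfderiv 𝓘(ℝ, E) φ (g.devel hc p 0) (mfderiv 𝓘(ℝ, E) 𝓘(ℝ, E) (g.devel hc p) 0 w)) := by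
  set ℓ : E →L[ℝ] ℝ :=
    (mvfderiv 𝓘(ℝ, E) φ (g.devel hc p 0)).comp (mfderiv 𝓘(ℝ, E) 𝓘(ℝ, E) (g.devel hc p) 0) with hℓ
  let α : Module.Dual ℝ (TangentSpace 𝓘(ℝ, E) p) := -(κ⁻¹ • ℓ.toLinearMap)
  refine ⟨g.sharp p α, fun w ↦ (val_sharp_apply g p α w).trans ?_⟩
  rfl

/-- **Completing the square for the potential**: with `m` the critical point,
`φ(devel v) = φ(devel m) + κ g_p(v − m, v − m)/2` for all `v` (`κ ≠ 0`). [folklore] -/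
theorem apply_devel_eq_min_add (hflat : g.leviCivita.IsFlat) {φ : M → ℝ}
    (hφ : ContMDiff 𝓘(ℝ, E) 𝓘(ℝ, ℝ) ∞ φ) {κ : ℝ} (hκ : κ ≠ 0)
    (hHess : ∀ (x : M) (v : TangentSpace 𝓘(ℝ, E) x), g.hessian φ x v v = κ * g.val x v v)
    {m : E} (hm : ∀ w : E, g.val p m w =
      -(κ⁻¹ * mvfderiv 𝓘(ℝ, E) φ (g.devel hc p 0) (mfderiv 𝓘(ℝ, E) 𝓘(ℝ, E) (g.devel hc p) 0 w)))
    (v : E) :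
    φ (g.devel hc p v) = φ (g.devel hc p m) + κ * g.val p (v - m) (v - m) / 2 := by
  set ℓ : E →L[ℝ] ℝ :=
    (mvfderiv 𝓘(ℝ, E) φ (g.devel hc p 0)).comp (mfderiv 𝓘(ℝ, E) 𝓘(ℝ, E) (g.devel hc p) 0) with hℓ
  have hq := apply_devel_eq_quadratic g hc p hflat hφ hHess
  have hcs : φ (g.devel hc p 0) + ℓ v + κ * g.val p v v / 2 =
      (φ (g.devel hc p 0) + ℓ m + κ * g.val p m m / 2) + κ * g.val p (v - m) (v - m) / 2 :=
    quadratic_eq_apply_min_add (V := E) (g.val p) (fun a b ↦ g.symm p a b) ℓ hκ hm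
      (φ (g.devel hc p 0)) v
  rw [hq v, hq m]
  exact hcs

/-- **The development of a complete flat manifold carrying `φ` with `Hess φ = κ g`, `κ ≠ 0`,
`g` Riemannian, is injective** (so the manifold is simply connected: "a flat quotient `ℝⁿ/Γ`
carries no such `φ`: `Γ` would fix the minimum point"). Two points of one fibre differ by an
affine deck transformation `τ` of the development (`exists_deck`); `φ ∘ devel` is invariant under
`τ`, and by `apply_devel_eq_min_add` its value determines `g_p(v − m, v − m)`, so `τ m = m`;
a deck transformation with a fixed point is the identity (`affine_eq_id_of_devel_comp`).
[cite: MunteanuWang2016, Thm 1.2 (p. 3)] [cite: Lee2018, Ch. 12, Thm. 12.8] -/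
theorem devel_injective_of_hessian_eq (hflat : g.leviCivita.IsFlat) (hg : g.IsRiemannian)
    {φ : M → ℝ} (hφ : ContMDiff 𝓘(ℝ, E) 𝓘(ℝ, ℝ) ∞ φ) {κ : ℝ} (hκ : κ ≠ 0)
    (hHess : ∀ (x : M) (v : TangentSpace 𝓘(ℝ, E) x), g.hessian φ x v v = κ * g.val x v v) :
    Injective (g.devel hc p) := by
  intro w₁ w₂ h12
  obtain ⟨a, Lτ, -, hw, hdeck⟩ := g.exists_deck hc p hflat h12
  obtain ⟨m, hm⟩ := exists_val_eq_neg_linearPart g hc p φ κ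
  set τ : E → E := fun w ↦ a + Lτ w with hτ
  -- `τ` fixes the critical point `m`
  have hfix : τ m = m := by
    have h1 : φ (g.devel hc p (τ m)) = φ (g.devel hc p m) := by rw [hdeck m]
    rw [apply_devel_eq_min_add g hc p hflat hφ hκ hHess hm (τ m)] at h1
    have h2 : κ * g.val p (τ m - m) (τ m - m) = 0 := by linarith
    have h3 : g.val p (τ m - m) (τ m - m) = 0 := (mul_eq_zero.1 h2).resolve_left hκ
    by_contra hne
    exact (hg p (τ m - m) (sub_ne_zero.2 hne)).ne' h3
  have hid := g.affine_eq_id_of_devel_comp hc p hflat a (Lτ : E →L[ℝ] E) (τ := τ) (fun w ↦ rfl)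
    hdeck hfix w₁
  rw [← hw]
  exact hid.symm

end Devel

/-! ### Flat metrics: `Ric = 0`, `R = 0`, and the Hessian of a shrinker potential -/

section Flat

variable {E : Type*} [NormedAddCommGroup E] [NormedSpace ℝ E] [FiniteDimensional ℝ E]
  [CompleteSpace E] {H : Type*} [TopologicalSpace H] {I : ModelWithCorners ℝ E H}
  {M : Type*} [TopologicalSpace M] [ChartedSpace H M] [IsManifold I ∞ M]
  (g : PseudoRiemannianMetric I ∞ E (TangentSpace I : M → Type _)) [g.HasLeviCivita]

omit [FiniteDimensional ℝ E] [CompleteSpace E] in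
/-- A flat Levi-Civita connection has vanishing Ricci tensor. [cite: Lee2018, Thm. 8.34 (a)] -/
theorem ricci_apply_eq_zero_of_isFlat (hflat : g.leviCivita.IsFlat) (x : M)
    (X Y : TangentSpace I x) : g.ricci x X Y = 0 := by
  rw [ricci_apply, CovariantDerivative.ricci_eq_zero_of_isFlat _ hflat x]
  rfl

omit [CompleteSpace E] in
/-- A flat Levi-Civita connection has vanishing scalar curvature. [cite: Lee2018, Thm. 8.34 (a)] -/
theorem scalarCurvature_eq_zero_of_isFlat (hflat : g.leviCivita.IsFlat) (x : M) :
    g.scalarCurvature x = 0 := by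
  have h0 : g.ricci x = 0 := CovariantDerivative.ricci_eq_zero_of_isFlat _ hflat x
  rw [PseudoRiemannianMetric.scalarCurvature, h0, trace_zero]

omit [FiniteDimensional ℝ E] [CompleteSpace E] in
/-- On a flat gradient shrinker `Ric + Hess φ = ½ g` the potential has `Hess φ = ½ g`.
[cite: MunteanuWang2016, Thm 1.2 (p. 3)] -/
theorem hessian_eq_half_of_isFlat (hflat : g.leviCivita.IsFlat) {φ : M → ℝ}
    (hsol : ∀ (x : M) (X Y : TangentSpace I x),
      g.ricci x X Y + g.hessian φ x X Y = (1 / 2 : ℝ) * g.val x X Y)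
    (x : M) (v : TangentSpace I x) : g.hessian φ x v v = (1 / 2 : ℝ) * g.val x v v := by
  have h := hsol x v v
  rwa [ricci_apply_eq_zero_of_isFlat g hflat x, zero_add] at h

end Flat

/-! ### Dimension three: a complete flat normalised shrinker is the Gaussian soliton -/

section Three

variable (N : Type*) [TopologicalSpace N] [T2Space N]
  [ChartedSpace (EuclideanSpace ℝ (Fin 3)) N] [IsManifold (𝓡 3) ∞ N] [ConnectedSpace N]
  (h : PseudoRiemannianMetric (𝓡 3) ∞ (EuclideanSpace ℝ (Fin 3))
    (TangentSpace (𝓡 3) : N → Type _)) [h.HasLeviCivita]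
  (φ : N → ℝ) (hh : h.IsRiemannian)

/-- **A complete connected flat `3`-manifold carrying `φ` with `Ric + Hess φ = ½ h` is globally
isometric to `(ℝ³, δ)`, with `φ = c + |x − a|²/4` in the Euclidean coordinate.** There are a
diffeomorphism `Ψ : N ≅ ℝ³` with `⟪dΨ v, dΨ w⟫ = h(v, w)` and `a ∈ ℝ³`, `c ∈ ℝ` with
`φ(x) = c + ‖Ψ x − a‖²/4` — derivation (o) of `threeShrinkerClassification_modelData` up to the
normalisation: the development at a point is injective (`devel_injective_of_hessian_eq`, "`Γ`
would fix the minimum point") and surjective (`devel_surjective`), hence inverts to an isometry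
onto `(ℝ³, h_p)` (`exists_diffeomorph_of_bijective_devel`), which is linearly isometric to
`(ℝ³, δ)` (`exists_continuousLinearEquiv_inner_eq`); the potential is the completed square
`apply_devel_eq_min_add`. Completeness: closed `h`-balls compact (Hopf–Rinow,
`isGeodesicallyComplete_of_isCompact_closedBall`).
[cite: MunteanuWang2016, Thm 1.2 (p. 3)] [cite: Lee2018, Ch. 12, Thm. 12.8] -/
theorem exists_isometry_euclidean_of_isFlat
    (hcpl : ∀ (x : N) (r : ℝ≥0), IsCompact {y : N | h.edist hh x y ≤ r})
    (hφ : ContMDiff (𝓡 3) 𝓘(ℝ, ℝ) ∞ φ)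
    (hsol : ∀ (x : N) (X Y : TangentSpace (𝓡 3) x),
      h.ricci x X Y + h.hessian φ x X Y = (1 / 2 : ℝ) * h.val x X Y)
    (hflat : h.leviCivita.IsFlat) :
    ∃ (Ψ : Diffeomorph (𝓡 3) (𝓡 3) N (EuclideanSpace ℝ (Fin 3)) ∞)
      (a : EuclideanSpace ℝ (Fin 3)) (c : ℝ),
      (∀ (x : N) (v w : TangentSpace (𝓡 3) x),
        ⟪mfderiv (𝓡 3) (𝓡 3) Ψ x v, mfderiv (𝓡 3) (𝓡 3) Ψ x w⟫ = h.val x v w) ∧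
      ∀ x : N, φ x = c + ‖Ψ x - a‖ ^ 2 / 4 := by
  haveI := h.contMDiffCovariantDerivative_leviCivita_one
  have hc : IsGeodesicallyComplete h.leviCivita :=
    isGeodesicallyComplete_of_isCompact_closedBall hh hcpl
  obtain ⟨p⟩ : Nonempty N := inferInstance
  have hHess := hessian_eq_half_of_isFlat h hflat hsol
  have h2 : (1 / 2 : ℝ) ≠ 0 := by norm_num
  have hinj : Injective (h.devel hc p) := devel_injective_of_hessian_eq h hc p hflat hh hφ h2 hHess
  have hbij : Bijective (h.devel hc p) := ⟨hinj, h.devel_surjective hc p hflat⟩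
  obtain ⟨Φ, hΦD, hΦ⟩ := h.exists_diffeomorph_of_bijective_devel hc p hflat hbij
  obtain ⟨m, hm⟩ := exists_val_eq_neg_linearPart h hc p φ (1 / 2)
  have hmin := apply_devel_eq_min_add h hc p hflat hφ h2 hHess hm
  obtain ⟨ι, hι⟩ := exists_continuousLinearEquiv_inner_eq (h.val p) (h.symm p)
    fun v hv ↦ hh p v hv
  refine ⟨Φ.trans ι.toDiffeomorph, ι m, φ (h.devel hc p m), fun x v w ↦ ?_, fun x ↦ ?_⟩
  · -- the differential of the composite is `ι ∘ dΦ`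
    have hΨ : (⇑(Φ.trans ι.toDiffeomorph) : N → EuclideanSpace ℝ (Fin 3)) = ι ∘ Φ := by
      rw [Diffeomorph.coe_trans, ContinuousLinearEquiv.coe_toDiffeomorph]
    have hd0 : MDifferentiableAt (𝓡 3) (𝓡 3) Φ x := (Φ.contMDiff x).mdifferentiableAt (by simp)
    have hcomp : HasMFDerivAt (𝓡 3) (𝓡 3) (⇑(Φ.trans ι.toDiffeomorph)) x
        ((ι : EuclideanSpace ℝ (Fin 3) →L[ℝ] EuclideanSpace ℝ (Fin 3)).comp
          (mfderiv (𝓡 3) (𝓡 3) Φ x)) := by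
      rw [hΨ]
      exact (ι.hasMFDerivAt (x := Φ x)).comp x hd0.hasMFDerivAt
    have hd : ∀ u : TangentSpace (𝓡 3) x,
        mfderiv (𝓡 3) (𝓡 3) (⇑(Φ.trans ι.toDiffeomorph)) x u = ι (mfderiv (𝓡 3) (𝓡 3) Φ x u) :=
      fun u ↦ DFunLike.congr_fun hcomp.mfderiv u
    rw [hd v, hd w]
    exact (hι _ _).trans (hΦ x v w)
  · -- the potential in the Euclidean coordinate
    have hΨx : (Φ.trans ι.toDiffeomorph) x = ι (Φ x) := by
      rw [Diffeomorph.coe_trans, ContinuousLinearEquiv.coe_toDiffeomorph]; rfl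
    have hφx : φ x = φ (h.devel hc p (Φ x)) := by rw [hΦD x]
    have e : ⟪ι (Φ x - m), ι (Φ x - m)⟫ = h.val p (Φ x - m) (Φ x - m) := hι _ _
    rw [hφx, hmin (Φ x), hΨx, ← map_sub, ← real_inner_self_eq_norm_sq, e]
    ring

/-- **The normalisation fixes the constant: a complete connected flat normalised shrinker is
`(ℝ³, δ, |x − a|²/4)`.** With `R + |∇φ|² = φ` in addition: `φ = ‖Ψ x − a‖²/4` for the isometry
`Ψ : N ≅ (ℝ³, δ)` of `exists_isometry_euclidean_of_isFlat` — at the minimum point `Ψ⁻¹ a` of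
`φ = c + ‖Ψ − a‖²/4` one has `dφ = 0` (Fermat) and `R = 0` (flat), so `c = φ = R + |∇φ|² = 0`
(derivation (o): "the normalisation `0 + |x − a|²/4 = φ` gives `c = 0`").
[cite: MunteanuWang2016, Thm 1.2 (p. 3)] [cite: CaoHamiltonIlmanen2004, §4] -/
theorem exists_isometry_euclidean_of_isFlat_of_normalised
    (hcpl : ∀ (x : N) (r : ℝ≥0), IsCompact {y : N | h.edist hh x y ≤ r})
    (hφ : ContMDiff (𝓡 3) 𝓘(ℝ, ℝ) ∞ φ)
    (hsol : ∀ (x : N) (X Y : TangentSpace (𝓡 3) x),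
      h.ricci x X Y + h.hessian φ x X Y = (1 / 2 : ℝ) * h.val x X Y)
    (hnorm : ∀ x : N, h.scalarCurvature x + h.gradSq φ x = φ x)
    (hflat : h.leviCivita.IsFlat) :
    ∃ (Ψ : Diffeomorph (𝓡 3) (𝓡 3) N (EuclideanSpace ℝ (Fin 3)) ∞)
      (a : EuclideanSpace ℝ (Fin 3)),
      (∀ (x : N) (v w : TangentSpace (𝓡 3) x),
        ⟪mfderiv (𝓡 3) (𝓡 3) Ψ x v, mfderiv (𝓡 3) (𝓡 3) Ψ x w⟫ = h.val x v w) ∧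
      ∀ x : N, φ x = ‖Ψ x - a‖ ^ 2 / 4 := by
  obtain ⟨Ψ, a, c, hiso, hφeq⟩ :=
    exists_isometry_euclidean_of_isFlat N h φ hh hcpl hφ hsol hflat
  -- the minimum point of `φ`
  set x₀ : N := Ψ.symm a with hx₀
  have hΨx₀ : Ψ x₀ = a := Ψ.apply_symm_apply a
  have hφx₀ : φ x₀ = c := by rw [hφeq x₀, hΨx₀]; simp
  have hmin : IsMinOn φ univ x₀ := by
    intro x _
    rw [mem_setOf_eq, hφx₀, hφeq x]
    have : 0 ≤ ‖Ψ x - a‖ ^ 2 / 4 := by positivity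
    linarith
  -- `dφ = 0` there, so `|∇φ|² = 0`, and `R = 0`: the normalisation gives `c = 0`
  have hd : mvfderiv (𝓡 3) (-φ) x₀ = 0 := mvfderiv_eq_zero_of_isMaxOn hmin.neg
  have hgrad : h.gradSq φ x₀ = 0 := by
    rw [← h.gradSq_neg]
    exact h.gradSq_eq_zero_of_mvfderiv_eq_zero hd
  have hc0 : c = 0 := by
    have hn := hnorm x₀
    rw [scalarCurvature_eq_zero_of_isFlat h hflat x₀, hgrad, hφx₀] at hn
    linarith
  refine ⟨Ψ, a, hiso, fun x ↦ ?_⟩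
  rw [hφeq x, hc0, zero_add]

/-- **Disjunct (o) of `threeShrinkerClassification_modelData` in the flat case, reduced to the
Gaussian integral on the model.** For a complete connected flat normalised gradient shrinker
`(N³, h, φ)` (the fact's binder plus `h.leviCivita.IsFlat`): `R ≡ 0`, and for some `a ∈ ℝ³`,
`∫_N e^{-φ} dV_h = ∫_{ℝ³} e^{-|y−a|²/4} dV_δ` — the change of variables along the isometry
`Ψ : (N, h) ≅ (ℝ³, δ)` of `exists_isometry_euclidean_of_isFlat_of_normalised`
(`Diffeomorph.lintegral_comp_riemannianMeasure`). The right-hand side is `(4π)^{3/2} = 8π√π`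
(`dV_δ = dx`, `ThreeShrinker.riemannianMeasure_euclideanMetric`, and
`ThreeShrinker.lintegral_exp_neg_norm_sub_sq_div_four` of `ThreeShrinkerClassificationProofs.lean`;
Cao–Hamilton–Ilmanen 2004, §3: `Θ(ℝⁿ) = 1`), which gives disjunct (o) verbatim.
[cite: MunteanuWang2016, Thm 1.2 (p. 3)] [cite: CaoChenZhu2007, Lemma 4.6 (p. 77)]
[cite: CaoHamiltonIlmanen2004, §3] -/
theorem modelData_o_of_isFlat_gaussianIntegral [T3Space N] [MeasurableSpace N] [BorelSpace N]
    (hcpl : ∀ (x : N) (r : ℝ≥0), IsCompact {y : N | h.edist hh x y ≤ r})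
    (hφ : ContMDiff (𝓡 3) 𝓘(ℝ, ℝ) ∞ φ)
    (hsol : ∀ (x : N) (X Y : TangentSpace (𝓡 3) x),
      h.ricci x X Y + h.hessian φ x X Y = (1 / 2 : ℝ) * h.val x X Y)
    (hnorm : ∀ x : N, h.scalarCurvature x + h.gradSq φ x = φ x)
    (hflat : h.leviCivita.IsFlat) :
    (∀ x : N, h.scalarCurvature x = 0) ∧ ∃ a : EuclideanSpace ℝ (Fin 3),
      ∫⁻ x, ENNReal.ofReal (Real.exp (-φ x))
          ∂(riemannianMeasure (h.toContMDiffRiemannianMetric hh)) =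
        ∫⁻ y, ENNReal.ofReal (Real.exp (-(‖y - a‖ ^ 2 / 4)))
          ∂(riemannianMeasure
            ((euclideanMetric (EuclideanSpace ℝ (Fin 3))).toContMDiffRiemannianMetric
              isRiemannian_euclideanMetric)) := by
  refine ⟨scalarCurvature_eq_zero_of_isFlat h hflat, ?_⟩
  obtain ⟨Ψ, a, hiso, hφeq⟩ :=
    exists_isometry_euclidean_of_isFlat_of_normalised N h φ hh hcpl hφ hsol hnorm hflat
  refine ⟨a, ?_⟩
  -- change of variables along the isometry `Ψ : (N, h) → (ℝ³, δ)`
  have hcomp := Diffeomorph.lintegral_comp_riemannianMeasure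
    (hN := h.toContMDiffRiemannianMetric hh)
    (hM := (euclideanMetric (EuclideanSpace ℝ (Fin 3))).toContMDiffRiemannianMetric
      isRiemannian_euclideanMetric)
    Ψ (by simp) (fun x v ↦ by
      rw [toContMDiffRiemannianMetric_inner, toContMDiffRiemannianMetric_inner,
        euclideanMetric_apply]
      exact hiso x v v)
    (fun y ↦ ENNReal.ofReal (Real.exp (-(‖y - a‖ ^ 2 / 4))))
  have hfun : (fun x ↦ ENNReal.ofReal (Real.exp (-φ x))) =
      fun x ↦ ENNReal.ofReal (Real.exp (-(‖Ψ x - a‖ ^ 2 / 4))) := by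
    funext x; rw [hφeq x]
  rw [hfun, hcomp]

end Three


end ThreeShrinker

end Literature.Geometry.Riemannian

end
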